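import Mathlib.Topology.Algebra.Module.FiniteDimension
import Mathlib.Analysis.SpecialFunctions.Complex.Log
import Literature.Computability.AlgebraicComplexity.Polystability
import Literature.Computability.AlgebraicComplexity.OrbitClosureEuclidean
import Literature.Computability.AlgebraicComplexity.TensorPowerAction
import Literature.Computability.AlgebraicComplexity.TensorMomentMatrix
import Literature.Computability.AlgebraicComplexity.TensorMomentEquivariance
import Literature.Computability.AlgebraicComplexity.DetPerTensorPoly
import Literature.Computability.AlgebraicComplexity.KempfNessClosedOrbit
import HarnessLib

/-!
# `det_n` and `per_n` are polystable (Bürgisser–Ikenmeyer 2017, Cor. 2.9): discharge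

Sibling proof file of `Literature/Computability/AlgebraicComplexity/Polystability.lean`,
discharging its named fact
`Literature.Computability.AlgebraicComplexity.BurgisserIkenmeyer2017_polystable_det_per`:
for every `n`, the `SL_{n²}(ℂ)`-orbits of the generic determinant `det_n` and of the generic
permanent `per_n` under linear substitution of the `n²` variables are Zariski closed in coefficient
space (P. Bürgisser, C. Ikenmeyer, *Fundamental invariants of orbit closures*, J. Algebra 477
(2017), Def. 2.7 and Cor. 2.9).

## Proof

The printed proof (Prop. 2.8: the Hilbert–Mumford criterion as refined by Luna and Kempf — the
destabilising one-parameter subgroup may be taken in the centraliser of a reductive subgroup of the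
stabiliser, hence diagonal; then the support of `det_n`/`per_n`, the permutation matrices, whose
cyclic shifts sum to the all-ones matrix, forces the subgroup to be trivial) rests on three deep
inputs absent from Mathlib (existence of a closed orbit in the boundary, Hilbert–Mumford, Kempf/
Luna). We replace it by the **Kempf–Ness route**, proved from scratch in the support files:

1. `det_n = tensorToPoly (detTensor n)`, `per_n = tensorToPoly (perTensor n)` are the polynomial
   shadows of symmetric `n`-tensors on `Fin n × Fin n` (`DetPerTensorPoly.lean`), equivariantly for
   the tensor power action (`TensorPowerAction.lean`, `tensorToPoly_tensorAct`).
2. Their moment matrices are scalar (`TensorMomentMatrix.lean`,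
   `exists_momentMatrix_detTensor_eq_smul_one`: the support consists of the permutation-matrix
   words — the same combinatorial input as in the printed proof), hence all torus weights balance
   in every unitary frame (`TensorMomentEquivariance.lean`).
3. **Kempf–Ness** (`KempfNessClosedOrbit.lean`, `isClosed_tensorOrbit_of_critical`): the
   `SL`-orbit of such a critical tensor is closed in the classical topology.
4. **Transfer** (`isClosed_image_slOrbit_tensorToPoly`, this file): on symmetric tensors the map
   to degree-`n` coefficient vectors is an injective linear map of finite-dimensional spaces, hence a
   closed embedding, so the image of the `SL`-orbit of `det_n`/`per_n` in `Sym^n` is closed.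
5. **Bridge** (`isPolystable_of_isClosed_image_slOrbit`, this file): a form whose `SL`-orbit has
   closed image in `Sym^m` is polystable, i.e. the orbit is Zariski closed in the tree's all-monomial
   coefficient space: the Zariski closure lies in the classical closure by the tree's
   `mem_closure_range_of_ker_bind₁_le` (Chevalley's constructibility theorem + the density theorem
   SGA1 XII 2.2, `OrbitClosureEuclidean.lean`) applied to the polynomial map
   `A ↦ (coefficients of A · f, det A)` on all matrices, followed by a renormalisation of
   `A_k · f → y`, `det A_k → 1` into the orbit by `N`-th roots of `det A_k`.

## References

* P. Bürgisser, C. Ikenmeyer, *Fundamental invariants of orbit closures*, J. Algebra 477 (2017)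
  390–434, §2.2, Def. 2.7, Prop. 2.8, Cor. 2.9. [BurgisserIkenmeyer2017]
* G. Kempf, L. Ness, *The length of vectors in representation spaces*, LNM 732 (1979), Thm. 0.1,
  Thm. 0.2.
* D. Mumford, J. Fogarty, F. Kirwan, *Geometric Invariant Theory*, 3rd ed. (1994), Ch. 1 §2 and
  App. to Ch. 1 §C (closed orbits; Zariski vs. classical closure).
* J. M. Landsberg, *Geometry and Complexity Theory*, CUP (2017), Thm. 3.1.6.1. [LandsbergGCT2017]
-/

noncomputable section

open MvPolynomial Finset Filter
open scoped Matrix Topology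

namespace Literature.Computability.AlgebraicComplexity

section SymmEmbedding

variable {σ : Type*} [Fintype σ] [DecidableEq σ] {n : ℕ}

omit [Fintype σ] in
/-- The content counts letters: `tcontent j x = #{k | j k = x}`. [folklore] -/
theorem tcontent_apply (j : Fin n → σ) (x : σ) :
    tcontent j x = (Finset.univ.filter fun k => j k = x).card := by
  unfold tcontent
  rw [Finsupp.coe_finsetSum, Finset.sum_apply]
  simp_rw [Finsupp.single_apply]
  rw [Finset.sum_boole]
  rfl

omit [Fintype σ] in
/-- **Words with the same content differ by a permutation of the slots.** [folklore] -/
theorem exists_perm_of_tcontent_eq {j j' : Fin n → σ} (h : tcontent j' = tcontent j) :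
    ∃ π : Equiv.Perm (Fin n), j' = j ∘ π := by
  classical
  have hcard : ∀ x : σ, Fintype.card {k // j' k = x} = Fintype.card {k // j k = x} := by
    intro x
    rw [Fintype.card_subtype, Fintype.card_subtype]
    have h1 := tcontent_apply j' x
    have h2 := tcontent_apply j x
    rw [h] at h1
    rw [← h1.symm.trans h2]  -- both equal `tcontent j x`
  let e : ∀ x : σ, {k // j' k = x} ≃ {k // j k = x} := fun x => Fintype.equivOfCardEq (hcard x)
  let π : Fin n ≃ Fin n :=
    (Equiv.sigmaFiberEquiv j').symm.trans ((Equiv.sigmaCongrRight e).trans (Equiv.sigmaFiberEquiv j))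
  refine ⟨π, funext fun k => ?_⟩
  show j' k = j (π k)
  have : π k = ((e (j' k)) ⟨k, rfl⟩).1 := rfl
  rw [this]
  exact ((e (j' k)) ⟨k, rfl⟩).2.symm

/-- **`tensorToPoly` is injective on symmetric tensors** (through the degree-`n` coefficients):
if `S` is symmetric and all coefficients `coeff (tcontent j) (tensorToPoly S)` vanish then `S = 0`.
[folklore] -/
theorem eq_zero_of_symm_of_coeff_tensorToPoly_eq_zero {S : (Fin n → σ) → ℂ}
    (hS : ∀ (π : Equiv.Perm (Fin n)) (j : Fin n → σ), S (j ∘ π) = S j)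
    (h0 : ∀ j : Fin n → σ, coeff (tcontent j) (tensorToPoly S) = 0) : S = 0 := by
  funext j
  have h := h0 j
  rw [coeff_tensorToPoly] at h
  have hconst : ∀ j' ∈ Finset.univ.filter (fun j' : Fin n → σ => tcontent j' = tcontent j), S j' = S j := by
    intro j' hj'
    simp only [Finset.mem_filter, Finset.mem_univ, true_and] at hj'
    obtain ⟨π, rfl⟩ := exists_perm_of_tcontent_eq hj'
    exact hS π j
  rw [Finset.sum_congr rfl hconst, Finset.sum_const, nsmul_eq_mul] at h
  have hcard : (Finset.univ.filter (fun j' : Fin n → σ => tcontent j' = tcontent j)).card ≠ 0 := by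
    refine Finset.card_ne_zero.mpr ⟨j, ?_⟩
    simp
  rcases mul_eq_zero.mp h with h1 | h1
  · exact absurd (Nat.cast_eq_zero.mp h1) hcard
  · exact h1

omit [DecidableEq σ] in
/-- The tensor power action preserves symmetric tensors. [folklore] -/
theorem tensorAct_symm {S : (Fin n → σ) → ℂ}
    (hS : ∀ (π : Equiv.Perm (Fin n)) (j : Fin n → σ), S (j ∘ π) = S j) (A : Matrix σ σ ℂ)
    (π : Equiv.Perm (Fin n)) (j : Fin n → σ) : tensorAct A S (j ∘ π) = tensorAct A S j := by
  rw [tensorAct_apply, tensorAct_apply]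
  -- reindex `i ↦ i ∘ π`
  refine Fintype.sum_equiv (Equiv.arrowCongr π (Equiv.refl σ)) _ _ fun i => ?_
  have hi : (Equiv.arrowCongr π (Equiv.refl σ)) i = i ∘ π.symm := by
    funext a; simp [Equiv.arrowCongr_apply]
  rw [hi]
  have h1 : (∏ k, A ((j ∘ π) k) (i k)) = ∏ k, A (j k) ((i ∘ π.symm) k) := by
    rw [← Equiv.prod_comp π (fun k => A (j k) ((i ∘ ⇑π.symm) k))]
    simp
  rw [h1]
  congr 1
  have : i = (i ∘ π.symm) ∘ π := by funext a; simp
  conv_lhs => rw [this]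
  exact hS π _

/-- **Transfer of closedness from tensors to polynomials.** If `T₀` is a symmetric `n`-tensor whose
`SL`-orbit `{g • T₀ | det g = 1}` is closed, then the image in the degree-`n` coefficient space
`{d // |d| = n} → ℂ` of the `SL`-orbit of its polynomial shadow `tensorToPoly T₀` (the tree's
`slOrbit`) is closed: on symmetric tensors `S ↦ (coeff_d (tensorToPoly S))_d` is an injective
linear map of finite-dimensional spaces, hence a closed embedding. [folklore] -/
theorem isClosed_image_slOrbit_tensorToPoly {T₀ : (Fin n → σ) → ℂ}
    (hsymm : ∀ (π : Equiv.Perm (Fin n)) (j : Fin n → σ), T₀ (j ∘ π) = T₀ j)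
    (hclosed : IsClosed {S : (Fin n → σ) → ℂ | ∃ g : Matrix σ σ ℂ, g.det = 1 ∧ tensorAct g T₀ = S}) :
    IsClosed ((fun g (d : {d : σ →₀ ℕ // d.degree = n}) => coeffVec g d.1) ''
      slOrbit σ ℂ (tensorToPoly T₀)) := by
  -- the submodule of symmetric tensors
  let W : Submodule ℂ ((Fin n → σ) → ℂ) :=
    { carrier := {S | ∀ (π : Equiv.Perm (Fin n)) (j : Fin n → σ), S (j ∘ π) = S j}
      add_mem' := fun {a b} ha hb π j => by simp only [Pi.add_apply, ha π j, hb π j]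
      zero_mem' := fun π j => rfl
      smul_mem' := fun c {a} ha π j => by simp only [Pi.smul_apply, ha π j] }
  -- the coefficient map on `W`
  let ρ : MvPolynomial σ ℂ →ₗ[ℂ] ({d : σ →₀ ℕ // d.degree = n} → ℂ) :=
    { toFun := fun p d => coeffVec p d.1
      map_add' := fun p q => by funext d; simp [coeffVec_apply]
      map_smul' := fun c p => by funext d; simp [coeffVec_apply] }
  let L : W →ₗ[ℂ] ({d : σ →₀ ℕ // d.degree = n} → ℂ) := (ρ.comp tensorToPolyLin).comp W.subtype
  have hLapply : ∀ w : W, L w = fun d => coeffVec (tensorToPoly (w : (Fin n → σ) → ℂ)) d.1 := fun w => rfl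
  -- `L` is injective
  have hker : LinearMap.ker L = ⊥ := by
    rw [LinearMap.ker_eq_bot]
    intro w₁ w₂ h
    have hsub : L (w₁ - w₂) = 0 := by rw [map_sub, h, sub_self]
    have hzero : ((w₁ - w₂ : W) : (Fin n → σ) → ℂ) = 0 := by
      refine eq_zero_of_symm_of_coeff_tensorToPoly_eq_zero (w₁ - w₂).2 fun j => ?_
      have := congr_fun (hLapply (w₁ - w₂) ▸ hsub) ⟨tcontent j, degree_tcontent j⟩
      simpa [coeffVec_apply] using this
    have : w₁ - w₂ = 0 := Subtype.ext hzero
    exact sub_eq_zero.mp this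
  have hemb : Topology.IsClosedEmbedding L := LinearMap.isClosedEmbedding_of_injective hker
  -- the orbit inside `W`
  set OW : Set W := {w | ∃ g : Matrix σ σ ℂ, g.det = 1 ∧ tensorAct g T₀ = (w : (Fin n → σ) → ℂ)} with hOW
  have hOW_closed : IsClosed OW := by
    have : OW = ((↑) : W → (Fin n → σ) → ℂ) ⁻¹'
        {S : (Fin n → σ) → ℂ | ∃ g : Matrix σ σ ℂ, g.det = 1 ∧ tensorAct g T₀ = S} := rfl
    rw [this]
    exact hclosed.preimage continuous_subtype_val
  have himage : (fun g (d : {d : σ →₀ ℕ // d.degree = n}) => coeffVec g d.1) ''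
      slOrbit σ ℂ (tensorToPoly T₀) = L '' OW := by
    ext v
    constructor
    · rintro ⟨h, ⟨g, rfl⟩, rfl⟩
      have hmem : tensorAct (g : Matrix σ σ ℂ) T₀ ∈ W := fun π j => tensorAct_symm hsymm _ π j
      refine ⟨⟨tensorAct (g : Matrix σ σ ℂ) T₀, hmem⟩, ⟨(g : Matrix σ σ ℂ), g.2, rfl⟩, ?_⟩
      rw [hLapply]
      funext d
      simp only [tensorToPoly_tensorAct]
    · rintro ⟨w, ⟨g, hg, hgw⟩, rfl⟩
      refine ⟨linSubst σ ℂ g (tensorToPoly T₀), ⟨⟨g, hg⟩, rfl⟩, ?_⟩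
      rw [hLapply]
      funext d
      simp only [← tensorToPoly_tensorAct, hgw]
  rw [himage]
  exact hemb.isClosedMap OW hOW_closed

end SymmEmbedding

section Bridge

variable {σ : Type*} [Fintype σ] [DecidableEq σ]

omit [Fintype σ] [DecidableEq σ] in
/-- Homogeneous polynomials are eigenvectors of the scalar substitution `X i ↦ c • X i`:
`aeval (c • X) f = c ^ m • f` for `f` homogeneous of degree `m`. [folklore] -/
theorem aeval_smul_X_of_isHomogeneous {f : MvPolynomial σ ℂ} {m : ℕ} (hf : f.IsHomogeneous m)
    (c : ℂ) : aeval (fun i => c • (X i : MvPolynomial σ ℂ)) f = c ^ m • f := by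
  conv_lhs => rw [f.as_sum]
  conv_rhs => rw [f.as_sum]
  rw [map_sum, Finset.smul_sum]
  refine Finset.sum_congr rfl fun d hd => ?_
  have hdeg : d.degree = m := by
    have := hf (mem_support_iff.mp hd)
    rw [Finsupp.degree_eq_weight_one]
    exact this
  rw [aeval_monomial, monomial_eq, Algebra.algebraMap_eq_smul_one, smul_mul_assoc, one_mul,
    smul_eq_C_mul, smul_eq_C_mul, ← mul_assoc, ← map_mul, mul_comm (c ^ m)]
  rw [map_mul, mul_assoc]
  congr 1
  rw [Finsupp.prod, Finsupp.prod]
  have : ∀ i ∈ d.support, (c • (X i : MvPolynomial σ ℂ)) ^ d i = C (c ^ d i) * X i ^ d i := by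
    intro i _
    rw [smul_eq_C_mul, mul_pow, ← map_pow]
  rw [Finset.prod_congr rfl this, Finset.prod_mul_distrib, ← map_prod, Finset.prod_pow_eq_pow_sum,
    ← Finsupp.degree_apply, hdeg]

/-- Scalar matrices act on forms of degree `m` by `c ^ m`: `(c • A) · f = c ^ m • (A · f)`.
[folklore] -/
theorem linSubst_smul_of_isHomogeneous {f : MvPolynomial σ ℂ} {m : ℕ} (hf : f.IsHomogeneous m)
    (c : ℂ) (A : Matrix σ σ ℂ) : linSubst σ ℂ (c • A) f = c ^ m • linSubst σ ℂ A f := by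
  have h1 : c • A = A * (c • (1 : Matrix σ σ ℂ)) := by rw [Matrix.mul_smul, Matrix.mul_one]
  rw [h1, linSubst_mul, AlgHom.comp_apply]
  have h2 : linSubst σ ℂ (c • (1 : Matrix σ σ ℂ)) f = c ^ m • f := by
    unfold linSubst
    have : (fun i : σ => ∑ j, (c • (1 : Matrix σ σ ℂ)) j i • (X j : MvPolynomial σ ℂ)) =
        fun i => c • X i := by
      funext i
      simp only [Matrix.smul_apply, Matrix.one_apply, smul_eq_mul, mul_ite, mul_one, mul_zero, ite_smul,
        zero_smul]
      rw [Finset.sum_ite_eq' Finset.univ i, if_pos (Finset.mem_univ _)]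
    rw [this]
    exact aeval_smul_X_of_isHomogeneous hf c
  rw [h2, map_smul]

/-- **The bridge**: for a form `f` of degree `m` over `ℂ`, if the image of its `SL`-orbit in the
degree-`m` coefficient space is closed for the classical topology, then `f` is polystable
(its `SL`-orbit is Zariski closed in coefficient space). The Zariski closure of the orbit is
contained in its classical closure by the tree's `mem_closure_range_of_ker_bind₁_le` (Chevalley +
the density theorem SGA1 XII 2.2) applied to the polynomial map `A ↦ (coeffs of A · f, det A)` on
all matrices, whose values with last coordinate `1` are exactly the orbit points; a classical
limit of `A_k · f` with `det A_k → 1` is renormalised into the orbit by `N`-th roots of `det A_k`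
(`Matrix.det_smul`, homogeneity). Mumford, GIT Ch. 1 §2 / Landsberg 2017 Thm. 3.1.6.1.
[folklore] -/
theorem isPolystable_of_isClosed_image_slOrbit {f : MvPolynomial σ ℂ} {m : ℕ}
    (hf : f.IsHomogeneous m)
    (hclosed : IsClosed ((fun g (d : {d : σ →₀ ℕ // d.degree = m}) => coeffVec g d.1) ''
      slOrbit σ ℂ f)) : IsPolystable f := by
  classical
  intro y hy
  -- (i) `y` vanishes off degree `m`
  have hy0 : ∀ d : σ →₀ ℕ, d.degree ≠ m → y d = 0 := by
    intro d hd
    have := (mem_zariskiClosure_iff.mp hy) (X d) fun v hv => by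
      obtain ⟨h, ⟨g, rfl⟩, rfl⟩ := hv
      rw [aeval_X, coeffVec_apply]
      exact (linSubst_isHomogeneous _ hf).coeff_eq_zero hd
    simpa using this
  -- (ii) the degree-`m` part of `y` lies in the classical closure of the image of the orbit
  haveI hfin : Fintype {d : σ →₀ ℕ // d.degree = m} :=
    Fintype.subtype ((Finset.univ : Finset σ).finsuppAntidiag m) fun d => by
      simp [Finset.mem_finsuppAntidiag, Finsupp.degree_eq_sum]
  set ρ : MvPolynomial σ ℂ → ({d : σ →₀ ℕ // d.degree = m} → ℂ) :=
    fun g d => coeffVec g d.1 with hρdef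
  set z : {d : σ →₀ ℕ // d.degree = m} → ℂ := fun d => y d.1 with hz
  set P : {d : σ →₀ ℕ // d.degree = m} ⊕ Unit → MvPolynomial (σ × σ) ℂ :=
    Sum.elim (fun d => coeff d.1 (linSubst σ (MvPolynomial (σ × σ) ℂ) (Matrix.mvPolynomialX σ σ ℂ)
      (map (C : ℂ →+* MvPolynomial (σ × σ) ℂ) f))) (fun _ => detPoly σ ℂ) with hPdef
  set zz : {d : σ →₀ ℕ // d.degree = m} ⊕ Unit → ℂ := Sum.elim z (fun _ => 1) with hzz
  -- the values of `P` at a matrix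
  have hact : ∀ A : Matrix σ σ ℂ, (fun t => aeval (fun ij : σ × σ => A ij.1 ij.2) (P t)) =
      Sum.elim (ρ (linSubst σ ℂ A f)) (fun _ => A.det) := by
    intro A
    funext t
    rcases t with d | u
    · simp only [hPdef, Sum.elim_inl]
      exact eval_coeff_genericLinSubst f d.1 A
    · simp only [hPdef, Sum.elim_inr]
      exact eval_detPoly (fun ij : σ × σ => A ij.1 ij.2)
  -- the hypothesis of the tree lemma
  have hker : RingHom.ker (bind₁ P : MvPolynomial ({d : σ →₀ ℕ // d.degree = m} ⊕ Unit) ℂ →ₐ[ℂ]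
      MvPolynomial (σ × σ) ℂ) ≤ RingHom.ker (aeval zz :
        MvPolynomial ({d : σ →₀ ℕ // d.degree = m} ⊕ Unit) ℂ →ₐ[ℂ] ℂ) := by
    intro q hq
    rw [RingHom.mem_ker] at hq ⊢
    -- the test polynomial `q(·, 1)` on the full coefficient space
    set pq : MvPolynomial (σ →₀ ℕ) ℂ :=
      bind₁ (Sum.elim (fun d : {d : σ →₀ ℕ // d.degree = m} => X d.1) (fun _ => 1)) q with hpq
    have hev : ∀ v : (σ →₀ ℕ) → ℂ, aeval v pq =
        aeval (Sum.elim (fun d : {d : σ →₀ ℕ // d.degree = m} => v d.1) (fun _ => (1 : ℂ))) q := by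
      intro v
      have hfun : (fun i : {d : σ →₀ ℕ // d.degree = m} ⊕ Unit =>
          aeval v (Sum.elim (fun d : {d : σ →₀ ℕ // d.degree = m} =>
            (X d.1 : MvPolynomial (σ →₀ ℕ) ℂ)) (fun _ : Unit => 1) i)) =
          Sum.elim (fun d : {d : σ →₀ ℕ // d.degree = m} => v d.1) (fun _ : Unit => (1 : ℂ)) := by
        funext t
        rcases t with d | u <;> simp
      rw [hpq, aeval_bind₁, hfun]
    have hvan : ∀ v ∈ coeffVec '' slOrbit σ ℂ f, aeval v pq = 0 := by
      rintro _ ⟨h, ⟨g, rfl⟩, rfl⟩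
      rw [hev]
      have h1 : Sum.elim (fun d : {d : σ →₀ ℕ // d.degree = m} => coeffVec (linSubst σ ℂ (g : Matrix σ σ ℂ) f) d.1)
          (fun _ => (1 : ℂ)) = fun t => aeval (fun ij : σ × σ => (g : Matrix σ σ ℂ) ij.1 ij.2) (P t) := by
        rw [hact]
        funext t
        rcases t with d | u
        · rfl
        · simp [g.2]
      rw [h1, ← aeval_bind₁, hq, map_zero]
    have := (mem_zariskiClosure_iff.mp hy) pq hvan
    rwa [hev] at this
  have hcl := mem_closure_range_of_ker_bind₁_le P hker
  -- a sequence of matrices `A k` with `ρ (A k · f) → z`, `det (A k) → 1`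
  obtain ⟨u, hu, hulim⟩ := mem_closure_iff_seq_limit.mp hcl
  choose x hx using hu
  set A : ℕ → Matrix σ σ ℂ := fun k => Matrix.of fun i j => x k (i, j) with hA
  have hxA : ∀ k, (fun ij : σ × σ => A k ij.1 ij.2) = x k := fun k => funext fun ij => by
    rw [hA]; simp
  have huA : ∀ k, u k = Sum.elim (ρ (linSubst σ ℂ (A k) f)) (fun _ => (A k).det) := by
    intro k
    rw [← hx k, ← hact (A k), ← hxA k]
  rw [tendsto_pi_nhds] at hulim
  have hdet : Tendsto (fun k => (A k).det) atTop (𝓝 1) := by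
    have := hulim (Sum.inr ())
    simp only [huA, Sum.elim_inr, hzz] at this
    exact this
  have hcoef : ∀ d : {d : σ →₀ ℕ // d.degree = m},
      Tendsto (fun k => ρ (linSubst σ ℂ (A k) f) d) atTop (𝓝 (z d)) := by
    intro d
    have := hulim (Sum.inl d)
    simp only [huA, Sum.elim_inl, hzz] at this
    exact this
  -- renormalise: `μ k ^ N = det (A k)`, `μ k → 1`
  set N := Fintype.card σ with hN
  set μ : ℕ → ℂ := fun k => Complex.exp (Complex.log ((A k).det) / N) with hμ
  have hμlim : Tendsto μ atTop (𝓝 1) := by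
    have h1 : Tendsto (fun k => Complex.log ((A k).det)) atTop (𝓝 (Complex.log 1)) :=
      (continuousAt_clog (by simp [Complex.slitPlane, Complex.one_re])).tendsto.comp hdet
    rw [Complex.log_one] at h1
    have h2 : Tendsto (fun k => Complex.log ((A k).det) / N) atTop (𝓝 (0 / N)) := h1.div_const _
    rw [zero_div] at h2
    have h3 := (Complex.continuous_exp.tendsto 0).comp h2
    rwa [Complex.exp_zero] at h3
  have hdet_ne : ∀ᶠ k in atTop, (A k).det ≠ 0 :=
    (hdet.eventually_ne one_ne_zero)
  have hμN : ∀ᶠ k in atTop, μ k ^ N = (A k).det := by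
    filter_upwards [hdet_ne] with k hk
    by_cases hN0 : N = 0
    · haveI : IsEmpty σ := Fintype.card_eq_zero_iff.mp hN0
      rw [hN0, pow_zero, Matrix.det_isEmpty]
    · rw [hμ]
      simp only
      rw [← Complex.exp_nat_mul, mul_div_cancel₀ _ (Nat.cast_ne_zero.mpr hN0), Complex.exp_log hk]
  have hμ_ne : ∀ k, μ k ≠ 0 := fun k => Complex.exp_ne_zero _
  set g : ℕ → Matrix σ σ ℂ := fun k => (μ k)⁻¹ • A k with hg
  have hgdet : ∀ᶠ k in atTop, (g k).det = 1 := by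
    filter_upwards [hμN, hdet_ne] with k hk hk'
    rw [hg]
    simp only
    rw [Matrix.det_smul, ← hN, inv_pow, hk, inv_mul_cancel₀ hk']
  have hgact : ∀ k, ρ (linSubst σ ℂ (g k) f) = ((μ k)⁻¹) ^ m • ρ (linSubst σ ℂ (A k) f) := by
    intro k
    rw [hg]
    simp only
    rw [linSubst_smul_of_isHomogeneous hf]
    funext d
    simp [hρdef, coeffVec_apply]
  have hglim : Tendsto (fun k => ρ (linSubst σ ℂ (g k) f)) atTop (𝓝 z) := by
    rw [tendsto_pi_nhds]
    intro d
    have h1 : Tendsto (fun k => ((μ k)⁻¹) ^ m * ρ (linSubst σ ℂ (A k) f) d) atTop (𝓝 ((1⁻¹) ^ m * z d)) :=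
      ((hμlim.inv₀ one_ne_zero).pow m).mul (hcoef d)
    rw [inv_one, one_pow, one_mul] at h1
    refine h1.congr fun k => ?_
    rw [hgact]
    rfl
  have hmem : ∀ᶠ k in atTop, ρ (linSubst σ ℂ (g k) f) ∈
      (fun g (d : {d : σ →₀ ℕ // d.degree = m}) => coeffVec g d.1) '' slOrbit σ ℂ f := by
    filter_upwards [hgdet] with k hk
    exact ⟨linSubst σ ℂ (g k) f, ⟨⟨g k, hk⟩, rfl⟩, rfl⟩
  have hzcl : z ∈ closure ((fun g (d : {d : σ →₀ ℕ // d.degree = m}) => coeffVec g d.1) ''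
      slOrbit σ ℂ f) := mem_closure_of_tendsto hglim hmem
  rw [hclosed.closure_eq] at hzcl
  -- (iii) conclude
  obtain ⟨h, hh, hhz⟩ := hzcl
  refine ⟨h, hh, ?_⟩
  obtain ⟨gg, rfl⟩ := hh
  funext d
  by_cases hd : d.degree = m
  · exact congr_fun hhz ⟨d, hd⟩
  · rw [coeffVec_apply, (linSubst_isHomogeneous _ hf).coeff_eq_zero hd, hy0 d hd]

end Bridge

/-! ### Assembly -/

section Assembly

/-- A symmetric `n`-tensor with scalar moment matrix has polystable polynomial shadow: the
`SL`-orbit of `tensorToPoly T₀` is Zariski closed. Kempf–Ness closedness + transfer + bridge.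
[folklore] -/
theorem isPolystable_tensorToPoly_of_momentMatrix_eq_smul_one {σ : Type*} [Fintype σ] [DecidableEq σ]
    {n : ℕ} {T₀ : (Fin n → σ) → ℂ} (hsymm : ∀ (π : Equiv.Perm (Fin n)) (j : Fin n → σ), T₀ (j ∘ π) = T₀ j)
    {c : ℂ} (hc : momentMatrix T₀ = c • (1 : Matrix σ σ ℂ)) : IsPolystable (tensorToPoly T₀) := by
  refine isPolystable_of_isClosed_image_slOrbit (isHomogeneous_tensorToPoly T₀) ?_
  refine isClosed_image_slOrbit_tensorToPoly hsymm ?_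
  exact isClosed_tensorOrbit_of_critical T₀ fun U hU θ hθ =>
    weightSum_tensorAct_eq_zero_of_momentMatrix_eq_smul_one hc hU θ hθ

/-- **Bürgisser–Ikenmeyer 2017, Corollary 2.9 (`det_n` and `per_n` clauses), discharged**: for every
`n`, the generic determinant `det_n` and the generic permanent `per_n` are polystable — their
`SL_{n²}(ℂ)`-orbits are Zariski closed. The printed proof (Prop. 2.8: Hilbert–Mumford criterion
refined by Luna and Kempf, applied to the diagonal torus in the stabiliser) is replaced by the
Kempf–Ness route: `det_n`, `per_n` are the polynomial shadows of the symmetric tensors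
`detTensor n`, `perTensor n`, whose moment matrices are scalar
(`exists_momentMatrix_detTensor_eq_smul_one`, the support being the permutation-matrix words —
exactly the combinatorial input of the printed proof of Cor. 2.9), so their `SL`-orbits are closed
(`isClosed_tensorOrbit_of_critical`), and closed orbits are Zariski closed
(`isPolystable_of_isClosed_image_slOrbit`). [cite: BurgisserIkenmeyer2017, Cor. 2.9] -/
theorem BurgisserIkenmeyer2017_polystable_det_per_holds : BurgisserIkenmeyer2017_polystable_det_per := by
  intro n
  refine ⟨?_, ?_⟩
  · rw [← tensorToPoly_detTensor]
    obtain ⟨c, hc⟩ := exists_momentMatrix_detTensor_eq_smul_one n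
    exact isPolystable_tensorToPoly_of_momentMatrix_eq_smul_one
      (fun π j => patternTensor_comp_perm _ j π) hc
  · rw [← tensorToPoly_perTensor]
    obtain ⟨c, hc⟩ := exists_momentMatrix_perTensor_eq_smul_one n
    exact isPolystable_tensorToPoly_of_momentMatrix_eq_smul_one
      (fun π j => patternTensor_comp_perm _ j π) hc

end Assembly

end Literature.Computability.AlgebraicComplexity
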